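import Summits.Ventures.CertifiedManyBodySolver.Theorems.M3x2EdgeSplitSymReplaySemantics
import HarnessLib

/-!
# SymReplay S1 — the CAR normal-orderer `nfWord` is FAITHFUL (`wordOp w = polyOp (nfWord w)`), kernel demos (T3; proofs by hub-lb-sym-plan-1, rev 2)
No summit or crux statement is proved here; no certificate beyond toys is replayed; nothing here predicts superconductivity.
-/

noncomputable section

namespace Summit.Ventures.CertifiedManyBodySolver.Theorems.SymReplay

open Matrix Finset
open Literature.MathematicalPhysics.QuantumLattice
open Literature.MathematicalPhysics.QuantumLattice.HubbardWave0
open Literature.MathematicalPhysics.QuantumLattice.ThermodynamicLimit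
open Literature.Probability.LatticeModels
open Literature.MathematicalPhysics.QuantumManyBody.StateRelaxation
open Summit.Ventures.CertifiedManyBodySolver.Theorems.WardSlot
open scoped ComplexOrder BigOperators

/-- `d4R` IS the tree's `d4Vec` (so `moveSite γ v x = d4Vec γ x + v`, the map of `PolySite.d4Emb γ v`). -/
theorem d4R_eq_d4Vec (γ : DihedralGroup 4) (e : Site 2) : d4R γ e = d4Vec γ e := by
  cases γ <;> rfl

/-- `flatSite` is the identity. -/
theorem flatSite_eq (x : Site 2) : flatSite x = x := by
  funext j; fin_cases j <;> rfl

/-- `moveWordF` is `moveWord`. -/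
theorem moveWordF_eq (γ : DihedralGroup 4) (v : Site 2) (w : Word) : moveWordF γ v w = moveWord γ v w := by
  simp [moveWordF, moveWord, flatSite_eq]

/-! ### Kernel demos (`decide +kernel`: no `Lean.ofReduceBool`) — the checker is non-vacuous -/

/-- `c_{0↑} c†_{0↑} = 1 − c†_{0↑} c_{0↑}`. -/
example : isZero (psub (nfWord [ann 0 0, cre 0 0]) [(1, []), (-1, [cre 0 0, ann 0 0])]) = true := by
  decide +kernel

/-- `[H_{bond}, S⁺] = 0` (spin rotation). -/
example : isZero (nfPoly (comm (hamPoly bond2) (spinPlusPoly bond2))) = true := by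
  decide +kernel

/-- The toy certificate PASSES the checker — the whole pipeline replayed in the kernel. -/
theorem toyCert_check : symCheck toyCert = true := by decide +kernel

/-- Its value. -/
theorem toyCert_value : symValue toyCert = (-23) / 4 := by decide +kernel

/-- Coefficient off by `1/4`: the checker REJECTS (negative control). -/
example : symCheck { toyCert with c := (-11) / 2 } = false := by decide +kernel

/-- The lever: `toyCanonCert` (5 SOS factors, `useCanon := true`) passes … -/
theorem toyCanonCert_check : symCheck toyCanonCert = true := by decide +kernel

/-- … and only because of the canonicaliser (negative control). -/
example : symCheck { toyCanonCert with useCanon := false } = false := by decide +kernel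

/-- The matrix-form (`gramM`) toy certificate passes with the same value. -/
theorem toyCertM_check : symCheck toyCertM = true ∧ symValue toyCertM = symValue toyCert := by decide +kernel

/-- `wordOp` of the empty word. -/
@[simp] theorem wordOp_nil (Λ' : Finset (Site 2)) : wordOp Λ' [] = 1 := by
  simp [wordOp]

/-- `wordOp` of a cons. -/
@[simp] theorem wordOp_cons (Λ' : Finset (Site 2)) (ℓ : Letter) (u : Word) :
    wordOp Λ' (ℓ :: u) = letterOp Λ' ℓ * wordOp Λ' u := by
  simp [wordOp]

/-! #### Proof of S1 (no `sorry`): list algebra of `polyOp`, three letter-level CAR identities, the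
eight branches of `insL`, support bookkeeping, and the induction behind `nfWord`. -/

/-- Helper `polyOp_nil` (S1 chain). -/
@[simp] theorem polyOp_nil (Λ' : Finset (Site 2)) : polyOp Λ' [] = 0 := by
  simp [polyOp]

/-- Helper `polyOp_cons` (S1 chain). -/
@[simp] theorem polyOp_cons (Λ' : Finset (Site 2)) (t : ℚ × Word) (p : QPoly) :
    polyOp Λ' (t :: p) = ((t.1 : ℚ) : ℂ) • wordOp Λ' t.2 + polyOp Λ' p := by
  simp [polyOp]

/-- Helper `polyOp_append` (S1 chain). -/
theorem polyOp_append (Λ' : Finset (Site 2)) (p q : QPoly) :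
    polyOp Λ' (p ++ q) = polyOp Λ' p + polyOp Λ' q := by
  induction p with
  | nil => simp
  | cons t p ih => rw [List.cons_append, polyOp_cons, polyOp_cons, ih, add_assoc]

/-- Helper `polyOp_consNeg` (S1 chain). -/
theorem polyOp_consNeg (Λ' : Finset (Site 2)) (m : Letter) (p : QPoly) :
    polyOp Λ' (consNeg m p) = -(letterOp Λ' m * polyOp Λ' p) := by
  induction p with
  | nil => simp [consNeg]
  | cons t p ih =>
    rw [show consNeg m (t :: p) = (-t.1, m :: t.2) :: consNeg m p from rfl, polyOp_cons, ih, polyOp_cons,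
      mul_add, mul_smul_comm, neg_add]
    rw [wordOp_cons, Rat.cast_neg, neg_smul]

/-- Helper `polyOp_map_mul` (S1 chain). -/
theorem polyOp_map_mul (Λ' : Finset (Site 2)) (c : ℚ) (p : QPoly) :
    polyOp Λ' (p.map fun t => (c * t.1, t.2)) = ((c : ℚ) : ℂ) • polyOp Λ' p := by
  induction p with
  | nil => simp
  | cons t p ih => rw [List.map_cons, polyOp_cons, ih, polyOp_cons, smul_add, Rat.cast_mul, mul_smul]

/-- The operator of a letter inside the frame. -/
theorem letterOp_of_mem (Λ' : Finset (Site 2)) (ℓ : Letter) (h : ℓ.x ∈ Λ') :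
    letterOp Λ' ℓ = ladderLetter (orb (PolySite.pt ℓ.x h) ℓ.s, ℓ.dag) := by
  simp [letterOp, dif_pos h]

/-- `siteEq` decides equality of sites. -/
theorem siteEq_iff (x y : Site 2) : siteEq x y = true ↔ x = y := by
  constructor
  · intro h
    simp only [siteEq, Bool.and_eq_true, beq_iff_eq] at h
    funext i
    fin_cases i
    · exact h.1
    · exact h.2
  · rintro rfl
    simp [siteEq]

/-- `modeEq` decides equality of orbitals. -/
theorem modeEq_iff {Λ' : Finset (Site 2)} (a b : Letter) (ha : a.x ∈ Λ') (hb : b.x ∈ Λ') :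
    a.modeEq b = true ↔ orb (PolySite.pt a.x ha) a.s = orb (PolySite.pt b.x hb) b.s := by
  constructor
  · intro h
    simp only [Letter.modeEq, Bool.and_eq_true, beq_iff_eq, siteEq_iff] at h
    obtain ⟨hx, hs⟩ := h
    have hp : PolySite.pt a.x ha = PolySite.pt b.x hb := Subtype.ext (congrArg toLex hx)
    rw [hp, hs]
  · intro h
    have h1 : (PolySite.pt a.x ha, a.s) = (PolySite.pt b.x hb, b.s) := toLex.injective h
    have hx : a.x = b.x := by
      have h2 := congrArg (fun p : PolySite Λ' × Fin 2 => ofLex p.1.1) h1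
      simpa using h2
    have hs : a.s = b.s := congrArg Prod.snd h1
    simp [Letter.modeEq, siteEq_iff, hx, hs]

/-- `c c = 0`. -/
theorem annihilation_mul_self' {ι : Type*} [LinearOrder ι] [Fintype ι] (i : ι) :
    annihilation i * annihilation i = (0 : Matrix (Finset ι) (Finset ι) ℂ) := by
  have h : (2 : ℂ) • (annihilation i * annihilation i) = 0 := by
    rw [two_smul]; exact annihilation_anticommute_holds i i
  exact (smul_eq_zero.1 h).resolve_left two_ne_zero

/-- H1: two letters of the same kind on the same orbital multiply to zero. -/
theorem letterOp_mul_self_kind (Λ' : Finset (Site 2)) (a b : Letter) (ha : a.x ∈ Λ') (hb : b.x ∈ Λ')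
    (hk : a.dag = b.dag) (he : a.modeEq b = true) : letterOp Λ' a * letterOp Λ' b = 0 := by
  rw [letterOp_of_mem Λ' a ha, letterOp_of_mem Λ' b hb, (modeEq_iff a b ha hb).1 he, hk]
  cases b.dag
  · simp [ladderLetter, annihilation_mul_self']
  · simp [ladderLetter, creation_mul_self]

/-- H2: two letters of the same kind anticommute. -/
theorem letterOp_mul_same_kind (Λ' : Finset (Site 2)) (a b : Letter) (ha : a.x ∈ Λ') (hb : b.x ∈ Λ')
    (hk : a.dag = b.dag) : letterOp Λ' a * letterOp Λ' b = -(letterOp Λ' b * letterOp Λ' a) := by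
  rw [letterOp_of_mem Λ' a ha, letterOp_of_mem Λ' b hb, hk]
  cases b.dag
  · simp only [ladderLetter]
    exact eq_neg_of_add_eq_zero_left (annihilation_anticommute_holds _ _)
  · simp only [ladderLetter, if_true]
    exact eq_neg_of_add_eq_zero_left (creation_anticomm _ _)

/-- H3: an annihilator passing a creator, `c_a c†_b = δ_ab − c†_b c_a`. -/
theorem letterOp_ann_mul_cre (Λ' : Finset (Site 2)) (a b : Letter) (ha : a.x ∈ Λ') (hb : b.x ∈ Λ')
    (hka : a.dag = false) (hkb : b.dag = true) :
    letterOp Λ' a * letterOp Λ' b =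
      (if a.modeEq b = true then 1 else 0) - letterOp Λ' b * letterOp Λ' a := by
  rw [letterOp_of_mem Λ' a ha, letterOp_of_mem Λ' b hb, hka, hkb]
  simp only [ladderLetter, if_true, Bool.false_eq_true, if_false]
  rw [annihilation_mul_creation]
  by_cases he : a.modeEq b = true
  · rw [if_pos ((modeEq_iff a b ha hb).1 he), if_pos he]
  · rw [if_neg (fun h => he ((modeEq_iff a b ha hb).2 h)), if_neg he]

/-- Faithfulness of one insertion step. -/
theorem insL_faithful (Λ' : Finset (Site 2)) (ℓ : Letter) (hℓ : ℓ.x ∈ Λ') (u : Word) (hu : SuppIn u Λ') :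
    letterOp Λ' ℓ * wordOp Λ' u = polyOp Λ' (insL ℓ u) := by
  induction u with
  | nil => simp [insL]
  | cons m rest ih =>
    have hm : m.x ∈ Λ' := hu m List.mem_cons_self
    have hrest : SuppIn rest Λ' := fun a ha => hu a (List.mem_cons_of_mem _ ha)
    have IH := ih hrest
    rw [wordOp_cons]
    cases hd : ℓ.dag <;> cases hmd : m.dag
    · -- both annihilators
      simp only [insL, hd, hmd, Bool.false_eq_true, if_false]
      by_cases he : ℓ.modeEq m = true
      · rw [if_pos he, polyOp_nil, ← mul_assoc,
          letterOp_mul_self_kind Λ' ℓ m hℓ hm (by rw [hd, hmd]) he, zero_mul]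
      · rw [if_neg he]
        by_cases hl : ℓ.modeLt m = true
        · rw [if_pos hl]; simp
        · rw [if_neg hl, polyOp_consNeg, ← IH, ← mul_assoc,
            letterOp_mul_same_kind Λ' ℓ m hℓ hm (by rw [hd, hmd]), neg_mul, mul_assoc]
    · -- ℓ annihilator, m creator
      simp only [insL, hd, hmd, Bool.false_eq_true, if_false, if_true]
      rw [polyOp_append, polyOp_consNeg, ← IH, ← mul_assoc, letterOp_ann_mul_cre Λ' ℓ m hℓ hm hd hmd,
        sub_mul, mul_assoc, sub_eq_add_neg]
      by_cases he : ℓ.modeEq m = true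
      · rw [if_pos he, if_pos he]; simp
      · rw [if_neg he, if_neg he]; simp
    · -- ℓ creator, m annihilator
      simp only [insL, hd, hmd, Bool.false_eq_true, if_false, if_true]
      simp
    · -- both creators
      simp only [insL, hd, hmd, if_true]
      by_cases he : ℓ.modeEq m = true
      · rw [if_pos he, polyOp_nil, ← mul_assoc,
          letterOp_mul_self_kind Λ' ℓ m hℓ hm (by rw [hd, hmd]) he, zero_mul]
      · rw [if_neg he]
        by_cases hl : ℓ.modeLt m = true
        · rw [if_pos hl]; simp
        · rw [if_neg hl, polyOp_consNeg, ← IH, ← mul_assoc,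
            letterOp_mul_same_kind Λ' ℓ m hℓ hm (by rw [hd, hmd]), neg_mul, mul_assoc]

/-- Letters of the words produced by `insL ℓ u` come from `ℓ :: u`. -/
theorem insL_letters (ℓ : Letter) (u : Word) : ∀ t ∈ insL ℓ u, t.2 ⊆ ℓ :: u := by
  induction u with
  | nil =>
    intro t ht
    simp only [insL, List.mem_singleton] at ht
    subst ht
    exact List.Subset.refl _
  | cons m rest ih =>
    have hcn : ∀ t ∈ consNeg m (insL ℓ rest), t.2 ⊆ ℓ :: m :: rest := by
      intro t ht
      simp only [consNeg, List.mem_map] at ht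
      obtain ⟨t0, ht0, rfl⟩ := ht
      intro a ha
      rcases List.mem_cons.1 ha with rfl | ha
      · simp
      · have := ih t0 ht0 ha
        rcases List.mem_cons.1 this with rfl | h
        · simp
        · simp [h]
    have hfull : ∀ t : ℚ × Word, t ∈ [((1 : ℚ), ℓ :: m :: rest)] → t.2 ⊆ ℓ :: m :: rest := by
      intro t ht
      simp only [List.mem_singleton] at ht
      subst ht
      exact List.Subset.refl _
    have hrest : ∀ t : ℚ × Word, t ∈ [((1 : ℚ), rest)] → t.2 ⊆ ℓ :: m :: rest := by
      intro t ht
      simp only [List.mem_singleton] at ht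
      subst ht
      exact List.subset_cons_of_subset _ (List.subset_cons_self _ _)
    intro t ht
    cases hd : ℓ.dag <;> cases hmd : m.dag <;>
      simp only [insL, hd, hmd, Bool.false_eq_true, if_false, if_true] at ht
    · split_ifs at ht
      · simp at ht
      · exact hfull t ht
      · exact hcn t ht
    · rw [List.mem_append] at ht
      rcases ht with ht | ht
      · split_ifs at ht
        · exact hrest t ht
        · simp at ht
      · exact hcn t ht
    · exact hfull t ht
    · split_ifs at ht
      · simp at ht
      · exact hfull t ht
      · exact hcn t ht

/-- Letters of the words of `nfWord w` come from `w`. -/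
theorem nfWord_letters (w : Word) : ∀ t ∈ nfWord w, t.2 ⊆ w := by
  induction w with
  | nil => intro t ht; simp only [nfWord, List.mem_singleton] at ht; subst ht; exact List.Subset.refl _
  | cons ℓ w ih =>
    intro t ht
    simp only [nfWord, List.mem_flatMap, List.mem_map] at ht
    obtain ⟨t0, ht0, t1, ht1, rfl⟩ := ht
    intro a ha
    have h := insL_letters ℓ t0.2 t1 ht1 ha
    rcases List.mem_cons.1 h with rfl | h
    · simp
    · exact List.mem_cons_of_mem _ (ih t0 ht0 h)

/-- Multiplying a supported polynomial by a letter on the left, through `insL`. -/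
theorem letterOp_mul_polyOp (Λ' : Finset (Site 2)) (ℓ : Letter) (hℓ : ℓ.x ∈ Λ') (P : QPoly)
    (hP : ∀ t ∈ P, SuppIn t.2 Λ') :
    letterOp Λ' ℓ * polyOp Λ' P =
      polyOp Λ' (P.flatMap fun t => (insL ℓ t.2).map fun t' => (t.1 * t'.1, t'.2)) := by
  induction P with
  | nil => simp
  | cons t P ih =>
    rw [List.flatMap_cons, polyOp_append, polyOp_cons, mul_add,
      ih (fun t' ht' => hP t' (List.mem_cons_of_mem _ ht')), polyOp_map_mul, mul_smul_comm,
      insL_faithful Λ' ℓ hℓ t.2 (hP t List.mem_cons_self)]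

/-- **S1 is PROVED** (no `sorry`): the CAR normal-orderer is faithful. -/
theorem stub_nfFaithful : NfFaithful := by
  intro Λ' w hw
  induction w with
  | nil => simp [nfWord]
  | cons ℓ w ih =>
    have hℓ : ℓ.x ∈ Λ' := hw ℓ List.mem_cons_self
    have hw' : SuppIn w Λ' := fun m hm => hw m (List.mem_cons_of_mem _ hm)
    rw [wordOp_cons, ih hw', show nfWord (ℓ :: w) =
      (nfWord w).flatMap (fun t => (insL ℓ t.2).map fun t' => (t.1 * t'.1, t'.2)) from rfl]
    exact letterOp_mul_polyOp Λ' ℓ hℓ (nfWord w)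
      (fun t ht a ha => hw' a (nfWord_letters w t ht ha))

end Summit.Ventures.CertifiedManyBodySolver.Theorems.SymReplay

end
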